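import Summits.HodgeConjecture.HodgeConjecture.Theorems.Ring2HypothesesDescentMotivatedNumerical
import Summits.HodgeConjecture.HodgeConjecture.Theorems.Ring2HypothesesDescentMotivatedCorrespondences
import Literature.AlgebraicGeometry.HodgeTheory.MotivatedClassesDeformationLeaves
import Summits.HodgeConjecture.HodgeConjecture.Theorems.EndoscopicMiddleDegreeIsotypicMiddleClassesAlgebraicStubTopGysinInjective
import HarnessLib

/-!
# Ring 2 hypotheses, descent face — DISCHARGE of the named fact `Andre1996_exists_motivated_of_motivated_pullback`
# (leaf A3 of André's deformation theorem): a class whose pull-back along `j : X ⟶ X̄` is motivated has a motivated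
# representative modulo `ker j^*`

research route conditional on HC_CM; not a corollary; Q11.4-sentence-2 already refuted in dim ≥ 3.
Cell `pub-hodge-ring2` (Hodge ladder STAGE 3), seat `ring2-b05` (binder row b05
`Ring2.Hypotheses.MotivatedImpliesAlgebraicAV`), gen 36. `HC_CM` (`Theses.RankFourFaces.CMAbelianHodge`) does
not occur in this file; nothing here proves a case of the Hodge conjecture; the row b05 stays OPEN.

The named fact (`HodgeTheory/MotivatedClassesDeformationLeaves`, leaf (A3) of `Andre1996_deformation`, André 1996 §5.1
p. 25 via Thm. 0.4: «Puisque la catégorie des motifs est abélienne (0.4) … en fait, `ξ_s` provient d'un cycle motivé sur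
`X̄`»): for a morphism `j : X ⟶ X̄` of smooth projective complex varieties and `Ā ∈ H²ᵖ(X̄(ℂ); ℂ)` with `j^* Ā` motivated,
there is a MOTIVATED `Ā'` with `j^* Ā' = j^* Ā`. In print this is the semisimplicity of motivated motives (Thm. 0.4,
resting on Prop. 3.3). Here it is derived from the part of Prop. 3.3 proved by this seat on the real carriers —
«≡ est l'égalité sur `A_mot(X)`», the non-degeneracy of the cup pairing on motivated classes
(`Theorems/Ring2HypothesesDescentMotivatedNumerical`) — by a duality argument that needs no category of motives:
with `W = j^*(A_motᵖ(X̄)) ⊆ A_motᵖ(X)`, the annihilator `W^⊥ ⊆ A_mot^{n-p}(X)` consists of the motivated `b` with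
`j_* b ⟂ A_motᵖ(X̄)` (projection formula `⟨j^* a ∪ b⟩ = ⟨a ∪ j_* b⟩`, the tree's `cupPairing_gysinMap`), i.e. with
`j_* b = 0` (non-degeneracy on `X̄`, `j_*` preserves `A_mot`); hence `j^* Ā ⟂ W^⊥`, and `W^⊥⊥ = W` inside the
non-degenerately paired `A_motᵖ(X) × A_mot^{n-p}(X)`.

* §1 linear algebra: `mem_of_forall_orthogonal` (`W^⊥⊥ = W` for a pairing into a line, non-degenerate between two
  finite-dimensional subspaces); `cupProduct_eq_zero_of_cupPairing_eq_zero` (`⟨t, [X(ℂ)]⟩ = 0 ⟹ t = 0` in the top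
  degree, the tree's `eq_zero_of_kroneckerPairing_fundamentalClass_eq_zero`).
* §2 **`Andre1996_exists_motivated_of_motivated_pullback_holds`** — the named fact, PROVED; hence André's deformation
  theorem `Andre1996_deformation` (c24) holds modulo the three remaining published inputs {Mumford's curve lemma
  (A0), Hironaka's smooth compactification (A1), Deligne's théorème de la partie fixe `deligne_globalInvariantCycles`
  (c17)} (`Andre1996_deformation_holds_of_inputs`; (A5) was discharged by this seat in gen 34).

No definition, no NEW named fact, no sorry. References: Andre1996Motifs (Thm. 0.4 p. 7, Prop. 3.3 pp. 21–22, §5.1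
p. 25), Jannsen1992 (Lemma 2, the semisimplicity argument this file avoids), FultonYoungTableaux1997 (App. B (5)–(6)),
HatcherAT2002 (§3.3 Thm. 3.30, Prop. 3.38).
-/

noncomputable section

-- every declaration of this problem lives in `Summit.HodgeConjecture.HodgeConjecture.…` (summit = sub-problem)
set_option linter.dupNamespace false

open CategoryTheory AlgebraicGeometry MonoidalCategory CartesianMonoidalCategory
open Literature.AlgebraicTopology.SingularHomology Literature.Geometry.Kaehler
open Literature.AlgebraicGeometry Literature.AlgebraicGeometry.Motives
  Literature.AlgebraicGeometry.HodgeTheory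

namespace Summit.HodgeConjecture.HodgeConjecture.Theorems

/-! ## §1 Linear algebra and the top-degree Kronecker pairing -/

/-- **`W^⊥⊥ = W` for a pairing into a line.** Let `B : M × N → T`, `dim T = 1`, be non-degenerate between the
finite-dimensional subspaces `V ≤ M` and `V' ≤ N` (trivial left kernel on `V` against `V'`, trivial right kernel on
`V'` against `V`), `W ≤ V`, and `x ∈ V` with `B(x, b) = 0` for every `b ∈ V'` annihilating `W`. Then `x ∈ W`: every
`T`-valued functional on `V` is `B(·, b)|_V` for some `b ∈ V'` (injective maps between spaces of equal dimension), in
particular one killing `W` but not `x` if `x ∉ W`. [folklore] -/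
theorem mem_of_forall_orthogonal {K M N T : Type*} [Field K] [AddCommGroup M] [Module K M] [AddCommGroup N]
    [Module K N] [AddCommGroup T] [Module K T] [FiniteDimensional K M] [FiniteDimensional K N]
    [FiniteDimensional K T] (hT : Module.finrank K T = 1) (B : M →ₗ[K] N →ₗ[K] T) (V : Submodule K M)
    (V' : Submodule K N) (h₁ : ∀ v ∈ V, (∀ w ∈ V', B v w = 0) → v = 0)
    (h₂ : ∀ w ∈ V', (∀ v ∈ V, B v w = 0) → w = 0) {W : Submodule K M} (hW : W ≤ V) {x : M} (hx : x ∈ V)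
    (hxW : ∀ b ∈ V', (∀ w ∈ W, B w b = 0) → B x b = 0) : x ∈ W := by
  classical
  set Φ : V →ₗ[K] (V' →ₗ[K] T) := B.domRestrict₁₂ V V' with hΦdef
  set Ψ : V' →ₗ[K] (V →ₗ[K] T) := (B.domRestrict₁₂ V V').flip with hΨdef
  have hΦ : Function.Injective Φ := by
    rw [injective_iff_map_eq_zero]
    intro v hv
    exact Subtype.ext (h₁ v v.2 fun w hw ↦ by
      simpa [hΦdef, LinearMap.domRestrict₁₂_apply] using LinearMap.congr_fun hv ⟨w, hw⟩)
  have hΨ : Function.Injective Ψ := by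
    rw [injective_iff_map_eq_zero]
    intro w hw
    exact Subtype.ext (h₂ w w.2 fun v hv ↦ by
      simpa [hΨdef, LinearMap.domRestrict₁₂_apply] using LinearMap.congr_fun hw ⟨v, hv⟩)
  have hWT : Module.finrank K (V' →ₗ[K] T) = Module.finrank K V' := by
    rw [Module.finrank_linearMap, hT, mul_one]
  have hVT : Module.finrank K (V →ₗ[K] T) = Module.finrank K V := by
    rw [Module.finrank_linearMap, hT, mul_one]
  have h1 := LinearMap.finrank_le_finrank_of_injective hΦ
  have h2 := LinearMap.finrank_le_finrank_of_injective hΨ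
  rw [hWT] at h1
  rw [hVT] at h2
  have hsurj : Function.Surjective Ψ :=
    (LinearMap.injective_iff_surjective_of_finrank_eq_finrank (by rw [hVT]; omega)).1 hΨ
  by_contra hxW'
  -- a functional on `V` killing `W` but not `x`
  set WV : Submodule K V := W.comap V.subtype with hWV
  have hx' : (⟨x, hx⟩ : V) ∉ WV := fun h ↦ hxW' (by simpa [hWV] using h)
  obtain ⟨f, hfx, hfW⟩ := Submodule.exists_dual_map_eq_bot_of_notMem hx' inferInstance
  obtain ⟨t₀, ht₀⟩ : ∃ t₀ : T, t₀ ≠ 0 := Module.finrank_pos_iff_exists_ne_zero.mp (by rw [hT]; exact one_pos)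
  obtain ⟨b, hb⟩ := hsurj ((LinearMap.toSpanSingleton K T t₀) ∘ₗ f)
  have hbv : ∀ v : V, B v b = f v • t₀ := fun v ↦ by
    have := LinearMap.congr_fun hb v
    simpa [hΨdef, LinearMap.domRestrict₁₂_apply] using this
  have hbW : ∀ w ∈ W, B w b = 0 := by
    intro w hw
    have hwV : (⟨w, hW hw⟩ : V) ∈ WV := by simpa [hWV] using hw
    have hfw : f ⟨w, hW hw⟩ = 0 := by
      have : f ⟨w, hW hw⟩ ∈ WV.map f := Submodule.mem_map_of_mem hwV
      rwa [hfW, Submodule.mem_bot] at this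
    rw [show B w b = B ((⟨w, hW hw⟩ : V) : M) b from rfl, hbv, hfw, zero_smul]
  have hxb := hxW b b.2 hbW
  rw [show B x b = B ((⟨x, hx⟩ : V) : M) b from rfl, hbv] at hxb
  exact (smul_ne_zero hfx ht₀) hxb

variable {n : ℕ} {X : SchemeOver ℂ}

/-- `ξ ∪ y = 0` as soon as `⟨ξ ∪ y, [X(ℂ)]_μ⟩ = 0` (the Kronecker pairing with the fundamental class is injective on
the top degree of the connected closed manifold `X(ℂ)`: the tree's `eq_zero_of_kroneckerPairing_fundamentalClass_eq_zero`),
in the `cupPairing` spelling. [cite: HatcherAT2002, §3.3 Thm. 3.26 and p. 249] -/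
theorem cupProduct_eq_zero_of_cupPairing_eq_zero (μ : OrientationFamily) (hX : IsSmoothProjective n X) {a b : ℕ}
    (h : a + b = 2 * n) {ξ : complexBetti X a} {y : complexBetti X b} (h0 : cupPairing (μ hX) h ξ y = 0) :
    cupProduct h ξ y = 0 :=
  eq_zero_of_kroneckerPairing_fundamentalClass_eq_zero μ hX (by rwa [cupPairing_apply] at h0)

/-! ## §2 The discharge -/

/-- **DISCHARGE of `Andre1996_exists_motivated_of_motivated_pullback`** (leaf (A3) of André's deformation theorem;
André 1996 §5.1 via Thm. 0.4). For `j : X ⟶ X̄` (smooth projective, dimensions `n`, `m`) and `Ā ∈ H²ᵖ(X̄(ℂ); ℂ)` with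
`j^* Ā ∈ A_motᵖ(X)_ℂ`, there is `Ā' ∈ A_motᵖ(X̄)_ℂ` with `j^* Ā' = j^* Ā`. Proof: `W := j^*(A_motᵖ(X̄)) ≤ A_motᵖ(X)`
(Prop. 2.1 (ii), `Andre1996_motivatedClasses_pullback_holds`); for `b ∈ A_mot^{n-p}(X)` cup-orthogonal to `W`,
`j_* b ∈ A_mot^{m-p}(X̄)` (`complexGysin_mem_motivatedClasses`) is cup-orthogonal to `A_motᵖ(X̄)` by the projection
formula `⟨j_* b ∪ a, [X̄]⟩ = ⟨b ∪ j^* a, [X]⟩` (`cupPairing_gysinMap`), hence `j_* b = 0` (André Prop. 3.3 on `X̄`,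
`nondegenerate_motivatedClasses`), hence `⟨j^* Ā ∪ b⟩ = ⟨Ā ∪ j_* b⟩ = 0`; so `j^* Ā ∈ W^⊥⊥ = W` (Prop. 3.3 on `X`,
`mem_of_forall_orthogonal`). Degrees `p > n` or `p > m` are trivial (`H²ᵖ = 0`).
[cite: Andre1996Motifs, §5.1 (p. 25), Thm. 0.4 (p. 7) and Prop. 3.3 (pp. 21–22)]
[cite: FultonYoungTableaux1997, Appendix B §B.1 (5)–(6)] [cite: HatcherAT2002, §3.3 Thm. 3.30] -/
theorem Andre1996_exists_motivated_of_motivated_pullback_holds : Andre1996_exists_motivated_of_motivated_pullback := by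
  intro m n Xbar X j hXbar hX p Ā hĀ
  classical
  -- trivial degrees
  by_cases hpn : n < p
  · haveI := subsingleton_complexBetti hX (show 2 * n < 2 * p by omega)
    exact ⟨0, Submodule.zero_mem _, by rw [map_zero]; exact Subsingleton.elim _ _⟩
  by_cases hpm : m < p
  · haveI := subsingleton_complexBetti hXbar (show 2 * m < 2 * p by omega)
    exact ⟨0, Submodule.zero_mem _, by rw [Subsingleton.elim Ā 0]⟩
  obtain ⟨q, hq⟩ : ∃ q, p + q = n := ⟨n - p, by omega⟩
  obtain ⟨q', hq'⟩ : ∃ q', p + q' = m := ⟨m - p, by omega⟩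
  -- orientations and the Gysin morphism `j_* : H^{2q}(X) → H^{2q'}(X̄)`
  have hPD := hasPoincareDuality_complexOrientationFamily
  have hab : 2 * q + 2 * m = 2 * q' + 2 * n := by omega
  have hgys : complexGysin complexOrientationFamily hX hXbar j hab =
      gysinMap (complexOrientationFamily hX) (complexOrientationFamily hXbar) (AlgPoints.mapContinuous (L := ℂ) j)
        (show 2 * q + 2 * p = 2 * n by omega) (show 2 * q' + 2 * p = 2 * m by omega) :=
    complexGysin_eq_gysinMap hX hXbar j hab _ _
  -- the subspace `W = j^*(A_motᵖ(X̄))` of `A_motᵖ(X)`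
  set W : Submodule ℂ (complexBetti X (2 * p)) := (motivatedClasses m Xbar p).map (complexBetti.map j (2 * p)).hom
    with hWdef
  have hWle : W ≤ motivatedClasses n X p := by
    rintro _ ⟨a, ha, rfl⟩
    exact Andre1996_motivatedClasses_pullback_holds j hXbar hX p a ha
  -- finite-dimensionality and the line `H^{2n}(X(ℂ); ℂ)`
  haveI := finite_complexBetti hX (2 * p)
  haveI := finite_complexBetti hX (2 * q)
  haveI := finite_complexBetti hX (2 * n)
  obtain ⟨hD₁, hD₂⟩ := nondegenerate_motivatedClasses hX hq
  obtain ⟨-, hD₂'⟩ := nondegenerate_motivatedClasses hXbar hq'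
  have hmem : complexBetti.map j (2 * p) Ā ∈ W := by
    refine mem_of_forall_orthogonal (Ring2.Hypotheses.finrank_complexBetti_top hX)
      (cupProduct (show 2 * p + 2 * q = 2 * n by omega)) (motivatedClasses n X p) (motivatedClasses n X q) hD₁ hD₂
      hWle hĀ fun b hb hbW ↦ ?_
    -- `j_* b` is motivated and cup-orthogonal to `A_motᵖ(X̄)`, hence zero
    have hjb : complexGysin complexOrientationFamily hX hXbar j hab b ∈ motivatedClasses m Xbar q' :=
      Ring2.Hypotheses.complexGysin_mem_motivatedClasses complexOrientationFamily hX hXbar j hab (by omega) hb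
    have hjb0 : complexGysin complexOrientationFamily hX hXbar j hab b = 0 := by
      refine hD₂' _ hjb fun ξ hξ ↦ ?_
      refine cupProduct_eq_zero_of_cupPairing_eq_zero complexOrientationFamily hXbar _ ?_
      rw [cupPairing_apply, cupProduct_gradedComm_holds ℂ (ComplexPoints Xbar) (show 2 * p + 2 * q' = 2 * m by omega)
          (show 2 * q' + 2 * p = 2 * m by omega) ξ _,
        show ((-1 : ℂ) ^ (2 * p * (2 * q'))) = 1 by
          rw [show 2 * p * (2 * q') = 2 * (p * (2 * q')) by ring, pow_mul, neg_one_sq, one_pow], one_smul,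
        ← cupPairing_apply, hgys, cupPairing_gysinMap (hPD hXbar),
        cupPairing_apply, cupProduct_gradedComm_holds ℂ (ComplexPoints X) (show 2 * q + 2 * p = 2 * n by omega)
          (show 2 * p + 2 * q = 2 * n by omega) b _,
        show ((-1 : ℂ) ^ (2 * q * (2 * p))) = 1 by
          rw [show 2 * q * (2 * p) = 2 * (q * (2 * p)) by ring, pow_mul, neg_one_sq, one_pow], one_smul,
        hbW _ ⟨ξ, hξ, rfl⟩, map_zero, LinearMap.zero_apply]
    -- hence `⟨j^* Ā ∪ b⟩ = ⟨Ā ∪ j_* b⟩ = 0`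
    refine cupProduct_eq_zero_of_cupPairing_eq_zero complexOrientationFamily hX _ ?_
    rw [cupPairing_apply, cupProduct_gradedComm_holds ℂ (ComplexPoints X) (show 2 * p + 2 * q = 2 * n by omega)
        (show 2 * q + 2 * p = 2 * n by omega) _ b,
      show ((-1 : ℂ) ^ (2 * p * (2 * q))) = 1 by
        rw [show 2 * p * (2 * q) = 2 * (p * (2 * q)) by ring, pow_mul, neg_one_sq, one_pow], one_smul,
      ← cupPairing_apply, ← cupPairing_gysinMap (hPD hXbar) (AlgPoints.mapContinuous (L := ℂ) j)
        (show 2 * q + 2 * p = 2 * n by omega) (show 2 * q' + 2 * p = 2 * m by omega) b Ā, ← hgys, hjb0, map_zero,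
      LinearMap.zero_apply]
  obtain ⟨Ā', hĀ', hj⟩ := hmem
  exact ⟨Ā', hĀ', hj⟩

/-- **André's deformation theorem modulo three published inputs**: with (A3) discharged here and (A5) discharged in
gen 34 (`Andre1996_motivatedClasses_pullback_holds`), the tree's named fact `Andre1996_deformation` (André 1996 Thm. 0.5;
row c24 of the cell's table) follows from Mumford's curve lemma (A0), Hironaka's smooth compactification (A1) and Deligne's
théorème de la partie fixe `deligne_globalInvariantCycles` (c17) alone (`Andre1996_deformation_holds_of`).
[cite: Andre1996Motifs, Thm. 0.5 (p. 8) and §5.1 (p. 25)] [cite: DeligneHodgeII1971, Théorème 4.1.1] -/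
theorem Andre1996_deformation_holds_of_inputs (hcurve : Mumford_curveLemma_affine)
    (hHir : Hironaka1964_smoothCompactification) (hD : deligne_globalInvariantCycles) : Andre1996_deformation :=
  Andre1996_deformation_holds_of hcurve hHir hD Andre1996_exists_motivated_of_motivated_pullback_holds
    Andre1996_motivatedClasses_pullback_holds

end Summit.HodgeConjecture.HodgeConjecture.Theorems

end
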